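import Summits.QuantumFields.YangMills.Theorems.FluctuationComparisonRegPrIntLS2BetaBlockPairReadCover
import HarnessLib

/-!
# S2β · (SCT″-c)₁ (SRC-E) piece (ii) — «THE CORNER-SIZE COVER»: choosing M-1‴'s corner size letter as the ℓ²-corner size `M μ ν (i+1) y′ := √(Σ_{b : blockOf b.src ∈ corners(y′,μ,ν)} ‖X i b‖²)`
# makes ✓p838306 `linBudget_of_chartTower`'s `hXM` hold WITHOUT a cardinality factor, and its fine-site energy is `Σ_μΣ_νΣ_{y′} M² ≤ 4·d²·Σ_{b : PBond (F.P K) i} ‖X i b‖²`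
# (each bond lies in at most four corner sets per direction pair) — the cover letter (ii) of px10 g26's (SRC-E) SPEC (2026-09-01T00:49:48Z), feeding (L2-TOWER)

Cell `ym3-torus` (YM ladder rung R3 = continuum `SU(2)` Yang–Mills on the three-torus at fixed lattice data — a RUNG: NOT d = 4, NOT infinite volume, NOT a mass gap,
NOT Clay).  Width seat «width 10» `ym3-torus-px10` (gen 26); crux `stmt-QuantumFields-20520`, LINE g18-1 S2β.  `--kind proof --supports stmt-QuantumFields-20520 --as helper`,
count-neutral, DEFINITION-FREE (0 `def`, 0 `instance`, 0 `notation`, 0 `sorry`, default heartbeats); generic `Params` (pure lattice bookkeeping).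

WHAT IS PROVED (sorry-free).  ★`card_filter_corner_le_four` (the sites `y′` whose corner set `{y′, y′+e_μ, y′+e_ν, y′+e_μ+e_ν}` contains a block `B` are among
`{B, B−e_μ, B−e_ν, B−e_ν−e_μ}`); ★★`sum_corner_le` (double count: `Σ_{y′} Σ_{b ∈ corners(y′,μ,ν)} g b ≤ 4·Σ_b g b`, `g ≥ 0`); ★★`sum_sum_corner_le` (`Σ_μΣ_ν` of it: `≤ 4·d²·Σ_b g b`);
★`le_sqrt_sum_sq_of_mem` (`f b ≤ √(Σ_{corners} f²)` for `b` in the corner set — the `hXM` dock); ★★★`sum_sq_sqrtCorner_le`: **`Σ_μΣ_νΣ_{y′} (√(Σ_{b ∈ corners(y′,μ,ν)} f b²))² ≤ 4·d²·Σ_b f b²`**.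
USE: in ✓p838904 `c1Budget_of_letters` take `M μ ν (i+1) y′ := √(Σ_{b ∈ corners} ‖X i b‖²)` (`hM′` by `Real.sqrt_nonneg`, `hXM` by `le_sqrt_sum_sq_of_mem`); then the linear part
of `Bsrc` has fine-site energy `≤ c(i+1)²·4d²·Σ_b ‖X i b‖²` per level, which (L2-TOWER) (px12) and the (BKG) class decay turn into a purse-share with the weights
`w_j := L^{K−J−1−j}` (px10 SPEC count).

HONEST SCOPE.  Finite lattice bookkeeping; nothing of Bałaban's renormalisation-group analysis is asserted or proved ([Balaban1985Averaging] (2) p.17, Prop. 4 (128)–(135) pp.37–38);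
(L2-TOWER), the class decay, (REG) are NOT here; GAP♯∘ (`stub_uniformFibreGapOrbit`, registry 3732b7df UNTOUCHED, 0∕5), S2β, the five registered stubs, crux 20520, 19936, 19200 and
`YM3TorusSU2` are NOT proved; no registered stub is closed; rung R3 — NOT d = 4, NOT infinite volume, NOT a mass gap, NOT Clay; the Yang–Mills mass gap is NOT proved.
-/

set_option autoImplicit false

noncomputable section

open Finset

namespace Summit.QuantumFields.YangMills.Theorems.FluctuationComparisonRegPrIntLS2BetaCornerSizeCover

open Literature.MathematicalPhysics.QuantumFieldTheory.Balaban1983to89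
open Literature.MathematicalPhysics.QuantumFieldTheory.Balaban1983to89.B10StarCount (unshift_shift shift_unshift)

variable {P : Params} {k : ℕ}

/-- ★ The level-`(k+1)` sites `y′` whose corner set `{y′, y′+e_μ, y′+e_ν, y′+e_μ+e_ν}` contains a given block `B` are among `{B, B−e_μ, B−e_ν, B−e_ν−e_μ}`: at most `4`. [folklore] -/
theorem card_filter_corner_le_four (B : Site P (k + 1)) (μ ν : Fin P.d) :
    (univ.filter (fun y' : Site P (k + 1) => B = y' ∨ B = y'.shift μ ∨ B = y'.shift ν ∨ B = (y'.shift μ).shift ν)).card ≤ 4 := by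
  classical
  have hsub : univ.filter (fun y' : Site P (k + 1) => B = y' ∨ B = y'.shift μ ∨ B = y'.shift ν ∨ B = (y'.shift μ).shift ν) ⊆
      ({B, B.unshift μ, B.unshift ν, (B.unshift ν).unshift μ} : Finset (Site P (k + 1))) := by
    intro y' hy'
    rw [mem_filter] at hy'
    simp only [mem_insert, mem_singleton]
    rcases hy'.2 with h | h | h | h
    · exact Or.inl h.symm
    · exact Or.inr (Or.inl (by rw [h, unshift_shift]))
    · exact Or.inr (Or.inr (Or.inl (by rw [h, unshift_shift])))
    · exact Or.inr (Or.inr (Or.inr (by rw [h, unshift_shift, unshift_shift])))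
  refine (card_le_card hsub).trans ?_
  refine (card_insert_le _ _).trans ?_
  refine (Nat.succ_le_succ (card_insert_le _ _)).trans ?_
  refine (Nat.succ_le_succ (Nat.succ_le_succ (card_insert_le _ _))).trans ?_
  rw [card_singleton]

/-- ★★ **THE CORNER DOUBLE COUNT**: summing a nonnegative bond function over the corner sets of all sites `y′` counts each bond at most `4` times. [folklore] -/
theorem sum_corner_le (g : PBond P k → ℝ) (hg : ∀ b, 0 ≤ g b) (μ ν : Fin P.d) :
    ∑ y' : Site P (k + 1), ∑ b ∈ univ.filter (fun b : PBond P k =>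
        blockOf b.src = y' ∨ blockOf b.src = y'.shift μ ∨ blockOf b.src = y'.shift ν ∨ blockOf b.src = (y'.shift μ).shift ν), g b ≤
      4 * ∑ b : PBond P k, g b := by
  classical
  have hswap : ∑ y' : Site P (k + 1), ∑ b ∈ univ.filter (fun b : PBond P k =>
        blockOf b.src = y' ∨ blockOf b.src = y'.shift μ ∨ blockOf b.src = y'.shift ν ∨ blockOf b.src = (y'.shift μ).shift ν), g b =
      ∑ b : PBond P k, ∑ y' ∈ univ.filter (fun y' : Site P (k + 1) =>
        blockOf b.src = y' ∨ blockOf b.src = y'.shift μ ∨ blockOf b.src = y'.shift ν ∨ blockOf b.src = (y'.shift μ).shift ν), g b := by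
    simp only [sum_filter]
    rw [sum_comm]
  rw [hswap, mul_sum]
  refine sum_le_sum fun b _ => ?_
  rw [sum_const, nsmul_eq_mul]
  have hc := card_filter_corner_le_four (blockOf b.src) μ ν
  have : ((univ.filter (fun y' : Site P (k + 1) =>
        blockOf b.src = y' ∨ blockOf b.src = y'.shift μ ∨ blockOf b.src = y'.shift ν ∨ blockOf b.src = (y'.shift μ).shift ν)).card : ℝ) ≤ 4 := by
    exact_mod_cast hc
  exact mul_le_mul_of_nonneg_right this (hg b)

/-- ★★ Summed over the direction pair as well: at most `4·d²` counts per bond. [folklore] -/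
theorem sum_sum_corner_le (g : PBond P k → ℝ) (hg : ∀ b, 0 ≤ g b) :
    ∑ μ : Fin P.d, ∑ ν : Fin P.d, ∑ y' : Site P (k + 1), ∑ b ∈ univ.filter (fun b : PBond P k =>
        blockOf b.src = y' ∨ blockOf b.src = y'.shift μ ∨ blockOf b.src = y'.shift ν ∨ blockOf b.src = (y'.shift μ).shift ν), g b ≤
      4 * (P.d : ℝ) ^ 2 * ∑ b : PBond P k, g b := by
  calc _ ≤ ∑ μ : Fin P.d, ∑ ν : Fin P.d, 4 * ∑ b : PBond P k, g b :=
        sum_le_sum fun μ _ => sum_le_sum fun ν _ => sum_corner_le g hg μ ν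
    _ = _ := by rw [sum_const, sum_const, card_univ, Fintype.card_fin, smul_smul, nsmul_eq_mul]; push_cast; ring

/-- ★ **THE ℓ²-CORNER SIZE DOMINATES EACH CORNER BOND**: with `M(y′) := √(Σ_{b ∈ corners} f b²)`, every bond of the corner set has `f b ≤ M(y′)` — the size letter `hXM` of
✓`linBudget_of_chartTower` holds for this choice WITHOUT a cardinality factor. [folklore] -/
theorem le_sqrt_sum_sq_of_mem {s : Finset (PBond P k)} (f : PBond P k → ℝ) (hf : ∀ b, 0 ≤ f b) {b : PBond P k} (hb : b ∈ s) :
    f b ≤ Real.sqrt (∑ b' ∈ s, f b' ^ 2) := by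
  rw [← Real.sqrt_sq (hf b)]
  exact Real.sqrt_le_sqrt (single_le_sum (f := fun b' => f b' ^ 2) (fun b' _ => sq_nonneg _) hb)

/-- ★★★ **THE ENERGY OF THE ℓ²-CORNER SIZE**: `Σ_μΣ_νΣ_{y′} (√(Σ_{b ∈ corners(y′,μ,ν)} f b²))² ≤ 4·d²·Σ_b f b²`. [cite: Balaban1985Averaging, (2) p.17, Prop. 4 (128)-(135) pp.37-38] -/
theorem sum_sq_sqrtCorner_le (f : PBond P k → ℝ) :
    ∑ μ : Fin P.d, ∑ ν : Fin P.d, ∑ y' : Site P (k + 1),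
      Real.sqrt (∑ b ∈ univ.filter (fun b : PBond P k =>
        blockOf b.src = y' ∨ blockOf b.src = y'.shift μ ∨ blockOf b.src = y'.shift ν ∨ blockOf b.src = (y'.shift μ).shift ν), f b ^ 2) ^ 2 ≤
      4 * (P.d : ℝ) ^ 2 * ∑ b : PBond P k, f b ^ 2 := by
  have h := sum_sum_corner_le (fun b => f b ^ 2) (fun b => sq_nonneg _)
  refine le_trans (le_of_eq ?_) h
  refine sum_congr rfl fun μ _ => sum_congr rfl fun ν _ => sum_congr rfl fun y' _ => ?_
  exact Real.sq_sqrt (sum_nonneg fun b _ => sq_nonneg _)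

end Summit.QuantumFields.YangMills.Theorems.FluctuationComparisonRegPrIntLS2BetaCornerSizeCover

end
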